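import Summits.KontsevichZagierPeriods.KontsevichZagierPeriods.Theorems.SymplecticScissorsRealOnePeriodRelationsLoopLayerCells
import Summits.KontsevichZagierPeriods.KontsevichZagierPeriods.Theorems.SymplecticScissorsRealOnePeriodRelationsLoopLayerArcs
import Summits.KontsevichZagierPeriods.KontsevichZagierPeriods.Theorems.SymplecticScissorsRealOnePeriodRelationsStubHwLoopsFamily
import Literature.NumberTheory.Transcendental.CurvePeriodsEllipticIsogenousPathsProofs
import Literature.NumberTheory.Transcendental.CurvePeriodsTwoCurvesLoopsProofs
import Literature.NumberTheory.Transcendental.TwoCurvePeriodsHolds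

/-!
# Crux `RealOnePeriodRelations` (stmt-KontsevichZagierPeriods-10042) — THE LOOP LAYER, UNCONDITIONALLY
# (complete real elliptic integrals; complex multiplication and isogenies allowed)

Line `nash-retraction-thin-strip`, gen-1 lead, continuation c3 (reshape 5).  The line is complete modulo its apex, the named
fact `HuberWustholzCurvePeriods` (Huber–Wüstholz 2022, Thm 13.3 (2) for ALL smooth affine curves).  The tree proves that fact
for CLOSED paths on every elliptic curve over `ℚ̄` — complex multiplication allowed (`huberWustholzCurvePeriods_ellipticLoops_all`,
Masser's Theorem III via Chudnovsky) —, on all curves of one isogeny class (`huberWustholzCurvePeriods_of_isogenousEllipticLoops`),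
on two non-isogenous non-CM curves (`huberWustholzCurvePeriods_of_twoCurveLoops` with `HuberWustholzTwoCurvePeriods_holds`) and,
new with this layer, on an ARBITRARY finite family of elliptic curves (`LoopLayer.stub_hwLoopsFamily`, from the isotypic
splitting `HuberWustholzIsotypicSplitting_holds`).  On the real side closed paths are COMPLETE elliptic integrals, and this
file turns those sectors into unconditional layers of the crux through `SectorGlue.realOnePeriodRelations_of_sector`,
`stub_loopCells` and `stub_loopArcs`:

* `realOnePeriodRelations_loopLayer` — one isogeny class of ANY lattice `M` with algebraic invariants (CM allowed);
* `realOnePeriodRelations_twoCurveLoopLayer` — two non-isogenous non-CM curves;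
* `realOnePeriodRelations_loopLayer_family` — ANY finite family of real Weierstrass curves `y² = x³ + A_j x + B_j` over
  `ℚ̄ ∩ ℝ` with given lattices: every `ℤ`-combination with vanishing value of polynomial cells `∫_a^b P`, complete
  first/second-kind integrals over real ovals `∫_{e₁}^{e₂} (P₁ + P₂√f_j + P₃/√f_j)` (`e₁ < e₂` consecutive real roots) and
  complete integrals over real branches `∫_e^∞ c₀/√f_j` (`e` the largest real root) lies in
  `M₁ = closure (1a ∪ 1b ∪ 2 ∪ Green)`.  In particular the real shadows of the Legendre/CM relations (`ω₂ = τω₁`,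
  Masser's `Aη₁ − Cτη₂ = κω₂`, e.g. `∫_{-∞}^{1} dx/√(1−x³)`-type identities after the twist), of all isogeny relations
  (Landen, Gauss) between complete integrals, and of the oval = branch identities are generated by the four
  one-dimensional moves — with no hypothesis beyond the data.

[cite: HuberWustholz2022, Thm 13.3 (2), §13.2, Thm 15.3 (1),(3), §15.2.2] [cite: Masser1975, Ch. III Thm. III]
[cite: KontsevichZagier2001, §1.1–§1.2]
-/

noncomputable section

open scoped BigOperators Polynomial
open Set MeasureTheory MvPolynomial
open Literature.NumberTheory.Transcendental Literature.NumberTheory.Transcendental.CurvePeriods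
open Summit.KontsevichZagierPeriods.SymplecticScissors.RealOnePeriodRelationsNegative (M₁ H₁ crux_iff unitDom)

namespace Summit.KontsevichZagierPeriods.SymplecticScissors.RealOnePeriodRelations

namespace LoopLayer

/-- **THE LOOP LAYER OF THE CRUX ON ONE ISOGENY CLASS, CM ALLOWED, UNCONDITIONALLY.**  Let `M` be ANY lattice with
algebraic invariants (complex multiplication allowed) and `E_j : y² = x³ + A_j x + B_j` (`A_j, B_j` real algebraic) real
Weierstrass curves whose lattices `L_j` map by algebraic isogenies `z ↦ α_j z` into `ℂ/Λ_M`.  Every `ℤ`-combination with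
vanishing value of polynomial cells `∫_a^b P` (`a < b`, `P` real algebraic), COMPLETE first/second-kind integrals over real
ovals `∫_{e₁}^{e₂} (P₁ + P₂√f_j + P₃/√f_j)` (`e₁ < e₂` consecutive real roots of `f_j`) and complete integrals over real
branches `∫_e^∞ c₀/√f_j` (`e` the largest real root) lies in `M₁ = closure (1a ∪ 1b ∪ 2 ∪ Green)` — in particular the
real shadows of the CM relations `ω₂ = τ ω₁`, Masser's `A η₁ − C τ η₂ = κ ω₂` and of all isogeny relations between complete
elliptic integrals are generated by the four one-dimensional moves.  Proof: `SectorGlue.realOnePeriodRelations_of_sector`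
with `stub_loopCells`, `stub_loopArcs` and the tree's PROVED `huberWustholzCurvePeriods_of_isogenousEllipticLoops`.
[cite: HuberWustholz2022, Thm 13.3 (2), §13.2] [cite: Masser1975, Ch. III Thm. III, Lemma 3.1] [cite: KontsevichZagier2001, §1.2] -/
theorem realOnePeriodRelations_loopLayer : ∀ (k : ℕ) (A B : Fin k → ℝ), (∀ j, IsAlgebraic ℚ (A j)) →
    (∀ j, IsAlgebraic ℚ (B j)) → ∀ (M : PeriodPair), IsAlgebraic ℚ M.g₂ → IsAlgebraic ℚ M.g₃ →
    ∀ (L : Fin k → PeriodPair) (α : Fin k → ℂ), (∀ j, (L j).g₂ = -4 * (A j : ℂ)) → (∀ j, (L j).g₃ = -4 * (B j : ℂ)) →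
    (∀ j, α j ≠ 0) → (∀ j, IsAlgebraic ℚ (α j)) → (∀ j, ∀ l ∈ (L j).lattice, α j * l ∈ M.lattice) →
    ∀ c : KZ.FormalRep, c ∈ AddSubgroup.closure ((fun r : KZ.IntegralRep 1 => KZ.of r) ''
      {r | (∃ a b : ℝ, IsAlgebraic ℚ a ∧ IsAlgebraic ℚ b ∧ a < b ∧ r.domain = {z | z 0 ∈ Set.Ioo a b} ∧
            ∃ P : Polynomial (algebraicClosure ℚ ℝ), ∀ x ∈ Set.Ioo a b, r.integrand (fun _ => x) = Polynomial.aeval x P) ∨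
        (∃ j, ∃ e₁ e₂ : ℝ, IsAlgebraic ℚ e₁ ∧ IsAlgebraic ℚ e₂ ∧ e₁ < e₂ ∧ e₁ ^ 3 + A j * e₁ + B j = 0 ∧
          e₂ ^ 3 + A j * e₂ + B j = 0 ∧ (∀ x ∈ Set.Ioo e₁ e₂, 0 < x ^ 3 + A j * x + B j) ∧
          r.domain = {z | z 0 ∈ Set.Ioo e₁ e₂} ∧
          ∃ P₁ P₂ P₃ : Polynomial (algebraicClosure ℚ ℝ), ∀ x ∈ Set.Ioo e₁ e₂,
            r.integrand (fun _ => x) = Polynomial.aeval x P₁ + Polynomial.aeval x P₂ * Real.sqrt (x ^ 3 + A j * x + B j) +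
              Polynomial.aeval x P₃ / Real.sqrt (x ^ 3 + A j * x + B j)) ∨
        (∃ j, ∃ e c₀ : ℝ, IsAlgebraic ℚ e ∧ IsAlgebraic ℚ c₀ ∧ e ^ 3 + A j * e + B j = 0 ∧
          (∀ x : ℝ, e < x → 0 < x ^ 3 + A j * x + B j) ∧ r.domain = {z | e < z 0} ∧
          ∀ z ∈ r.domain, r.integrand z = c₀ / Real.sqrt ((z 0) ^ 3 + A j * (z 0) + B j))}) →
    KZ.eval c = 0 →
    c ∈ AddSubgroup.closure (KZ.domainAddRel ∪ KZ.integrandAddRel ∪ KZ.changeOfVariablesRel ∪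
      {g : KZ.FormalRep | ∃ (Δ : Set (Fin 2 → ℝ)) (A B S : (Fin 2 → ℝ) → ℝ) (r₀₁ r₁₂ r₀₂ : KZ.IntegralRep 1),
        Δ = {p | 0 ≤ p 0 ∧ 0 ≤ p 1 ∧ p 0 + p 1 ≤ 1} ∧ IsSemialgebraicFunOn ℚ Δ A ∧ IsSemialgebraicFunOn ℚ Δ B ∧
        ContinuousOn A Δ ∧ ContinuousOn B Δ ∧
        (∀ p : Fin 2 → ℝ, 0 < p 0 → 0 < p 1 → p 0 + p 1 < 1 →
          HasFDerivAt S (A p • ContinuousLinearMap.proj (R := ℝ) (φ := fun _ : Fin 2 => ℝ) 0 +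
            B p • ContinuousLinearMap.proj (R := ℝ) (φ := fun _ : Fin 2 => ℝ) 1) p) ∧
        r₀₁.domain = {z | z 0 ∈ Set.Ioo 0 1} ∧ r₁₂.domain = {z | z 0 ∈ Set.Ioo 0 1} ∧
        r₀₂.domain = {z | z 0 ∈ Set.Ioo 0 1} ∧ (∀ z ∈ r₀₁.domain, r₀₁.integrand z = A ![z 0, 0]) ∧
        (∀ z ∈ r₁₂.domain, r₁₂.integrand z = B ![1 - z 0, z 0] - A ![1 - z 0, z 0]) ∧
        (∀ z ∈ r₀₂.domain, r₀₂.integrand z = B ![0, z 0]) ∧ g = KZ.of r₀₁ + KZ.of r₁₂ - KZ.of r₀₂}) := by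
  intro k A B hA hB M hM₂ hM₃ L α hL₂ hL₃ hα hαalg hαM c hc heval
  change c ∈ M₁
  have hD : ∀ j, 4 * A j ^ 3 + 27 * B j ^ 2 ≠ 0 := by
    intro j h
    apply (L j).discr_ne_zero
    rw [hL₂ j, hL₃ j]
    have h' : ((4 * A j ^ 3 + 27 * B j ^ 2 : ℝ) : ℂ) = 0 := by rw [h]; simp
    push_cast at h'
    linear_combination (-16 : ℂ) * h'
  have hg₂ : ∀ j, IsAlgebraic ℚ (L j).g₂ := fun j => by
    rw [hL₂ j]; exact ((isAlgebraic_int 4).neg).mul (hA j).algebraMap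
  have hg₃ : ∀ j, IsAlgebraic ℚ (L j).g₃ := fun j => by
    rw [hL₃ j]; exact ((isAlgebraic_int 4).neg).mul (hB j).algebraMap
  refine SectorGlue.realOnePeriodRelations_of_sector _ _ _ (fun C hCalg hCsupp hC0 => ?_)
    (stub_loopCells k A B hA hB) (stub_loopArcs k A B hA hB hD) c hc heval
  refine huberWustholzCurvePeriods_of_isogenousEllipticLoops M hM₂ hM₃ C hCalg (fun s hs => ?_) hC0
  rcases hCsupp s hs with hU | ⟨j, hj, hcl⟩
  · exact Or.inr (Or.inr (Or.inr (by rw [hU]; rfl)))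
  · exact Or.inl ⟨L j, α j, hg₂ j, hg₃ j, hα j, hαalg j, hαM j,
      hj.trans (Ell.curve_eq_weierCurve (hL₂ j) (hL₃ j)).symm, hcl⟩

/-- **THE LOOP LAYER ON TWO NON-ISOGENOUS NON-CM CURVES, UNCONDITIONALLY** (apex: `huberWustholzCurvePeriods_of_twoCurveLoops`
with the tree's PROVED `HuberWustholzTwoCurvePeriods_holds` — the ten periods `1, 2πi, ωᵢ, ηᵢ, ωᵢ′, ηᵢ′` are independent):
complete real elliptic integrals on `E : y² = x³ + A₀x + B₀` and `E′ : y² = x³ + A₁x + B₁` together with polynomial cells.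
[cite: HuberWustholz2022, Thm 13.3 (2), Thm 15.3 (1)] [cite: KontsevichZagier2001, §1.2] -/
theorem realOnePeriodRelations_twoCurveLoopLayer : ∀ (A B : Fin 2 → ℝ), (∀ j, IsAlgebraic ℚ (A j)) →
    (∀ j, IsAlgebraic ℚ (B j)) → ∀ (L : Fin 2 → PeriodPair), (∀ j, (L j).g₂ = -4 * (A j : ℂ)) →
    (∀ j, (L j).g₃ = -4 * (B j : ℂ)) → ¬ (L 0).HasCM → ¬ (L 1).HasCM → ¬ (L 0).IsIsogenousTo (L 1) →
    ∀ c : KZ.FormalRep, c ∈ AddSubgroup.closure ((fun r : KZ.IntegralRep 1 => KZ.of r) ''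
      {r | (∃ a b : ℝ, IsAlgebraic ℚ a ∧ IsAlgebraic ℚ b ∧ a < b ∧ r.domain = {z | z 0 ∈ Set.Ioo a b} ∧
            ∃ P : Polynomial (algebraicClosure ℚ ℝ), ∀ x ∈ Set.Ioo a b, r.integrand (fun _ => x) = Polynomial.aeval x P) ∨
        (∃ j, ∃ e₁ e₂ : ℝ, IsAlgebraic ℚ e₁ ∧ IsAlgebraic ℚ e₂ ∧ e₁ < e₂ ∧ e₁ ^ 3 + A j * e₁ + B j = 0 ∧
          e₂ ^ 3 + A j * e₂ + B j = 0 ∧ (∀ x ∈ Set.Ioo e₁ e₂, 0 < x ^ 3 + A j * x + B j) ∧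
          r.domain = {z | z 0 ∈ Set.Ioo e₁ e₂} ∧
          ∃ P₁ P₂ P₃ : Polynomial (algebraicClosure ℚ ℝ), ∀ x ∈ Set.Ioo e₁ e₂,
            r.integrand (fun _ => x) = Polynomial.aeval x P₁ + Polynomial.aeval x P₂ * Real.sqrt (x ^ 3 + A j * x + B j) +
              Polynomial.aeval x P₃ / Real.sqrt (x ^ 3 + A j * x + B j)) ∨
        (∃ j, ∃ e c₀ : ℝ, IsAlgebraic ℚ e ∧ IsAlgebraic ℚ c₀ ∧ e ^ 3 + A j * e + B j = 0 ∧
          (∀ x : ℝ, e < x → 0 < x ^ 3 + A j * x + B j) ∧ r.domain = {z | e < z 0} ∧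
          ∀ z ∈ r.domain, r.integrand z = c₀ / Real.sqrt ((z 0) ^ 3 + A j * (z 0) + B j))}) →
    KZ.eval c = 0 →
    c ∈ AddSubgroup.closure (KZ.domainAddRel ∪ KZ.integrandAddRel ∪ KZ.changeOfVariablesRel ∪
      {g : KZ.FormalRep | ∃ (Δ : Set (Fin 2 → ℝ)) (A B S : (Fin 2 → ℝ) → ℝ) (r₀₁ r₁₂ r₀₂ : KZ.IntegralRep 1),
        Δ = {p | 0 ≤ p 0 ∧ 0 ≤ p 1 ∧ p 0 + p 1 ≤ 1} ∧ IsSemialgebraicFunOn ℚ Δ A ∧ IsSemialgebraicFunOn ℚ Δ B ∧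
        ContinuousOn A Δ ∧ ContinuousOn B Δ ∧
        (∀ p : Fin 2 → ℝ, 0 < p 0 → 0 < p 1 → p 0 + p 1 < 1 →
          HasFDerivAt S (A p • ContinuousLinearMap.proj (R := ℝ) (φ := fun _ : Fin 2 => ℝ) 0 +
            B p • ContinuousLinearMap.proj (R := ℝ) (φ := fun _ : Fin 2 => ℝ) 1) p) ∧
        r₀₁.domain = {z | z 0 ∈ Set.Ioo 0 1} ∧ r₁₂.domain = {z | z 0 ∈ Set.Ioo 0 1} ∧
        r₀₂.domain = {z | z 0 ∈ Set.Ioo 0 1} ∧ (∀ z ∈ r₀₁.domain, r₀₁.integrand z = A ![z 0, 0]) ∧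
        (∀ z ∈ r₁₂.domain, r₁₂.integrand z = B ![1 - z 0, z 0] - A ![1 - z 0, z 0]) ∧
        (∀ z ∈ r₀₂.domain, r₀₂.integrand z = B ![0, z 0]) ∧ g = KZ.of r₀₁ + KZ.of r₁₂ - KZ.of r₀₂}) := by
  intro A B hA hB L hL₂ hL₃ hCM₀ hCM₁ hiso c hc heval
  change c ∈ M₁
  have hD : ∀ j, 4 * A j ^ 3 + 27 * B j ^ 2 ≠ 0 := by
    intro j h
    apply (L j).discr_ne_zero
    rw [hL₂ j, hL₃ j]
    have h' : ((4 * A j ^ 3 + 27 * B j ^ 2 : ℝ) : ℂ) = 0 := by rw [h]; simp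
    push_cast at h'
    linear_combination (-16 : ℂ) * h'
  have hg₂ : ∀ j, IsAlgebraic ℚ (L j).g₂ := fun j => by
    rw [hL₂ j]; exact ((isAlgebraic_int 4).neg).mul (hA j).algebraMap
  have hg₃ : ∀ j, IsAlgebraic ℚ (L j).g₃ := fun j => by
    rw [hL₃ j]; exact ((isAlgebraic_int 4).neg).mul (hB j).algebraMap
  refine SectorGlue.realOnePeriodRelations_of_sector _ _ _ (fun C hCalg hCsupp hC0 => ?_)
    (stub_loopCells 2 A B hA hB) (stub_loopArcs 2 A B hA hB hD) c hc heval
  refine huberWustholzCurvePeriods_of_twoCurveLoops HuberWustholzTwoCurvePeriods_holds (L 0) (L 1)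
    (hg₂ 0) (hg₃ 0) (hg₂ 1) (hg₃ 1) hCM₀ hCM₁ hiso C hCalg (fun s hs => ?_) hC0
  rcases hCsupp s hs with hU | ⟨j, hj, hcl⟩
  · exact Or.inr (Or.inr (Or.inr (by rw [hU]; rfl)))
  · fin_cases j
    · exact Or.inl ⟨hj.trans (Ell.curve_eq_weierCurve (hL₂ 0) (hL₃ 0)).symm, hcl⟩
    · exact Or.inr (Or.inl ⟨hj.trans (Ell.curve_eq_weierCurve (hL₂ 1) (hL₃ 1)).symm, hcl⟩)

/-- **THE LOOP LAYER ON AN ARBITRARY FINITE FAMILY OF REAL ELLIPTIC CURVES OVER `ℚ̄ ∩ ℝ`** (CM and isogenies allowed),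
from the family apex `stub_hwLoopsFamily`: every `ℤ`-linear relation with vanishing value among polynomial cells and complete
real elliptic integrals of the first and second kind on the curves `y² = x³ + A_j x + B_j` is generated by 1a, 1b, 2 and Green.
[cite: HuberWustholz2022, Thm 13.3 (2), Thm 15.3 (1),(3)] [cite: KontsevichZagier2001, §1.2] -/
theorem realOnePeriodRelations_loopLayer_family : ∀ (k : ℕ) (A B : Fin k → ℝ), (∀ j, IsAlgebraic ℚ (A j)) →
    (∀ j, IsAlgebraic ℚ (B j)) → ∀ (L : Fin k → PeriodPair), (∀ j, (L j).g₂ = -4 * (A j : ℂ)) →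
    (∀ j, (L j).g₃ = -4 * (B j : ℂ)) →
    ∀ c : KZ.FormalRep, c ∈ AddSubgroup.closure ((fun r : KZ.IntegralRep 1 => KZ.of r) ''
      {r | (∃ a b : ℝ, IsAlgebraic ℚ a ∧ IsAlgebraic ℚ b ∧ a < b ∧ r.domain = {z | z 0 ∈ Set.Ioo a b} ∧
            ∃ P : Polynomial (algebraicClosure ℚ ℝ), ∀ x ∈ Set.Ioo a b, r.integrand (fun _ => x) = Polynomial.aeval x P) ∨
        (∃ j, ∃ e₁ e₂ : ℝ, IsAlgebraic ℚ e₁ ∧ IsAlgebraic ℚ e₂ ∧ e₁ < e₂ ∧ e₁ ^ 3 + A j * e₁ + B j = 0 ∧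
          e₂ ^ 3 + A j * e₂ + B j = 0 ∧ (∀ x ∈ Set.Ioo e₁ e₂, 0 < x ^ 3 + A j * x + B j) ∧
          r.domain = {z | z 0 ∈ Set.Ioo e₁ e₂} ∧
          ∃ P₁ P₂ P₃ : Polynomial (algebraicClosure ℚ ℝ), ∀ x ∈ Set.Ioo e₁ e₂,
            r.integrand (fun _ => x) = Polynomial.aeval x P₁ + Polynomial.aeval x P₂ * Real.sqrt (x ^ 3 + A j * x + B j) +
              Polynomial.aeval x P₃ / Real.sqrt (x ^ 3 + A j * x + B j)) ∨
        (∃ j, ∃ e c₀ : ℝ, IsAlgebraic ℚ e ∧ IsAlgebraic ℚ c₀ ∧ e ^ 3 + A j * e + B j = 0 ∧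
          (∀ x : ℝ, e < x → 0 < x ^ 3 + A j * x + B j) ∧ r.domain = {z | e < z 0} ∧
          ∀ z ∈ r.domain, r.integrand z = c₀ / Real.sqrt ((z 0) ^ 3 + A j * (z 0) + B j))}) →
    KZ.eval c = 0 →
    c ∈ AddSubgroup.closure (KZ.domainAddRel ∪ KZ.integrandAddRel ∪ KZ.changeOfVariablesRel ∪
      {g : KZ.FormalRep | ∃ (Δ : Set (Fin 2 → ℝ)) (A B S : (Fin 2 → ℝ) → ℝ) (r₀₁ r₁₂ r₀₂ : KZ.IntegralRep 1),
        Δ = {p | 0 ≤ p 0 ∧ 0 ≤ p 1 ∧ p 0 + p 1 ≤ 1} ∧ IsSemialgebraicFunOn ℚ Δ A ∧ IsSemialgebraicFunOn ℚ Δ B ∧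
        ContinuousOn A Δ ∧ ContinuousOn B Δ ∧
        (∀ p : Fin 2 → ℝ, 0 < p 0 → 0 < p 1 → p 0 + p 1 < 1 →
          HasFDerivAt S (A p • ContinuousLinearMap.proj (R := ℝ) (φ := fun _ : Fin 2 => ℝ) 0 +
            B p • ContinuousLinearMap.proj (R := ℝ) (φ := fun _ : Fin 2 => ℝ) 1) p) ∧
        r₀₁.domain = {z | z 0 ∈ Set.Ioo 0 1} ∧ r₁₂.domain = {z | z 0 ∈ Set.Ioo 0 1} ∧
        r₀₂.domain = {z | z 0 ∈ Set.Ioo 0 1} ∧ (∀ z ∈ r₀₁.domain, r₀₁.integrand z = A ![z 0, 0]) ∧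
        (∀ z ∈ r₁₂.domain, r₁₂.integrand z = B ![1 - z 0, z 0] - A ![1 - z 0, z 0]) ∧
        (∀ z ∈ r₀₂.domain, r₀₂.integrand z = B ![0, z 0]) ∧ g = KZ.of r₀₁ + KZ.of r₁₂ - KZ.of r₀₂}) := by
  intro k A B hA hB L hL₂ hL₃ c hc heval
  change c ∈ M₁
  have hD : ∀ j, 4 * A j ^ 3 + 27 * B j ^ 2 ≠ 0 := by
    intro j h
    apply (L j).discr_ne_zero
    rw [hL₂ j, hL₃ j]
    have h' : ((4 * A j ^ 3 + 27 * B j ^ 2 : ℝ) : ℂ) = 0 := by rw [h]; simp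
    push_cast at h'
    linear_combination (-16 : ℂ) * h'
  have hg : ∀ j, IsAlgebraic ℚ (L j).g₂ ∧ IsAlgebraic ℚ (L j).g₃ := fun j =>
    ⟨by rw [hL₂ j]; exact ((isAlgebraic_int 4).neg).mul (hA j).algebraMap,
     by rw [hL₃ j]; exact ((isAlgebraic_int 4).neg).mul (hB j).algebraMap⟩
  refine SectorGlue.realOnePeriodRelations_of_sector _ _ _ (fun C hCalg hCsupp hC0 => ?_)
    (stub_loopCells k A B hA hB) (stub_loopArcs k A B hA hB hD) c hc heval
  refine stub_hwLoopsFamily k L hg C hCalg (fun s hs => ?_) hC0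
  rcases hCsupp s hs with hU | ⟨j, hj, hcl⟩
  · exact Or.inr (Or.inr (by rw [hU]; rfl))
  · exact Or.inl ⟨j, hj.trans (Ell.curve_eq_weierCurve (hL₂ j) (hL₃ j)).symm, hcl⟩

/-- **THE LOOP LAYER ON ONE REAL ELLIPTIC CURVE, CM ALLOWED** (the one-element family of `realOnePeriodRelations_loopLayer_family`):
for `E : y² = x³ + Ax + B` (`A, B` real algebraic) with lattice `L` (`g₂ = −4A`, `g₃ = −4B`, complex multiplication allowed), every
`ℤ`-combination with vanishing value of polynomial cells, complete integrals `∫_{e₁}^{e₂} (P₁ + P₂√f + P₃/√f)` over the real oval and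
`∫_e^∞ c₀/√f` over the real branch lies in `M₁` — e.g. the relation between the two real half-periods (oval = branch) and, on a
CM curve, the real shadows of `ω₂ = τ ω₁` and of Masser's quasi-period relation.
[cite: HuberWustholz2022, Thm 13.3 (2), §13.2] [cite: Masser1975, Ch. III Thm. III] [cite: KontsevichZagier2001, §1.2] -/
theorem realOnePeriodRelations_loopLayer_one : ∀ (A B : ℝ), IsAlgebraic ℚ A → IsAlgebraic ℚ B →
    ∀ (L : PeriodPair), L.g₂ = -4 * (A : ℂ) → L.g₃ = -4 * (B : ℂ) →
    ∀ c : KZ.FormalRep, c ∈ AddSubgroup.closure ((fun r : KZ.IntegralRep 1 => KZ.of r) ''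
      {r | (∃ a b : ℝ, IsAlgebraic ℚ a ∧ IsAlgebraic ℚ b ∧ a < b ∧ r.domain = {z | z 0 ∈ Set.Ioo a b} ∧
            ∃ P : Polynomial (algebraicClosure ℚ ℝ), ∀ x ∈ Set.Ioo a b, r.integrand (fun _ => x) = Polynomial.aeval x P) ∨
        (∃ e₁ e₂ : ℝ, IsAlgebraic ℚ e₁ ∧ IsAlgebraic ℚ e₂ ∧ e₁ < e₂ ∧ e₁ ^ 3 + A * e₁ + B = 0 ∧
          e₂ ^ 3 + A * e₂ + B = 0 ∧ (∀ x ∈ Set.Ioo e₁ e₂, 0 < x ^ 3 + A * x + B) ∧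
          r.domain = {z | z 0 ∈ Set.Ioo e₁ e₂} ∧
          ∃ P₁ P₂ P₃ : Polynomial (algebraicClosure ℚ ℝ), ∀ x ∈ Set.Ioo e₁ e₂,
            r.integrand (fun _ => x) = Polynomial.aeval x P₁ + Polynomial.aeval x P₂ * Real.sqrt (x ^ 3 + A * x + B) +
              Polynomial.aeval x P₃ / Real.sqrt (x ^ 3 + A * x + B)) ∨
        (∃ e c₀ : ℝ, IsAlgebraic ℚ e ∧ IsAlgebraic ℚ c₀ ∧ e ^ 3 + A * e + B = 0 ∧
          (∀ x : ℝ, e < x → 0 < x ^ 3 + A * x + B) ∧ r.domain = {z | e < z 0} ∧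
          ∀ z ∈ r.domain, r.integrand z = c₀ / Real.sqrt ((z 0) ^ 3 + A * (z 0) + B))}) →
    KZ.eval c = 0 →
    c ∈ AddSubgroup.closure (KZ.domainAddRel ∪ KZ.integrandAddRel ∪ KZ.changeOfVariablesRel ∪
      {g : KZ.FormalRep | ∃ (Δ : Set (Fin 2 → ℝ)) (A B S : (Fin 2 → ℝ) → ℝ) (r₀₁ r₁₂ r₀₂ : KZ.IntegralRep 1),
        Δ = {p | 0 ≤ p 0 ∧ 0 ≤ p 1 ∧ p 0 + p 1 ≤ 1} ∧ IsSemialgebraicFunOn ℚ Δ A ∧ IsSemialgebraicFunOn ℚ Δ B ∧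
        ContinuousOn A Δ ∧ ContinuousOn B Δ ∧
        (∀ p : Fin 2 → ℝ, 0 < p 0 → 0 < p 1 → p 0 + p 1 < 1 →
          HasFDerivAt S (A p • ContinuousLinearMap.proj (R := ℝ) (φ := fun _ : Fin 2 => ℝ) 0 +
            B p • ContinuousLinearMap.proj (R := ℝ) (φ := fun _ : Fin 2 => ℝ) 1) p) ∧
        r₀₁.domain = {z | z 0 ∈ Set.Ioo 0 1} ∧ r₁₂.domain = {z | z 0 ∈ Set.Ioo 0 1} ∧
        r₀₂.domain = {z | z 0 ∈ Set.Ioo 0 1} ∧ (∀ z ∈ r₀₁.domain, r₀₁.integrand z = A ![z 0, 0]) ∧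
        (∀ z ∈ r₁₂.domain, r₁₂.integrand z = B ![1 - z 0, z 0] - A ![1 - z 0, z 0]) ∧
        (∀ z ∈ r₀₂.domain, r₀₂.integrand z = B ![0, z 0]) ∧ g = KZ.of r₀₁ + KZ.of r₁₂ - KZ.of r₀₂}) := by
  intro A B hA hB L hL₂ hL₃ c hc heval
  refine realOnePeriodRelations_loopLayer_family 1 (fun _ => A) (fun _ => B) (fun _ => hA) (fun _ => hB) (fun _ => L)
    (fun _ => hL₂) (fun _ => hL₃) c (AddSubgroup.closure_mono (Set.image_mono fun r hr => ?_) hc) heval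
  rcases hr with h | h | h
  · exact Or.inl h
  · exact Or.inr (Or.inl ⟨0, h⟩)
  · exact Or.inr (Or.inr ⟨0, h⟩)

end LoopLayer

end Summit.KontsevichZagierPeriods.SymplecticScissors.RealOnePeriodRelations

end
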